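import Summits.BirchSwinnertonDyer.BirchSwinnertonDyer.Theorems.KimAtThreeShallowEqDeepOffStratumNonAdditiveRows
import HarnessLib

/-!
# Route `KimAtThreeKolyvagin` (rung W2), crux `DeepUpperAtThreeOffKatoStratum` (item 19562) on its
# NON-ADDITIVE rows (registered stub `stub_nonAdditive`): the UPPER inequality from `BSD₃` by name
# (good ordinary `3`: Yan–Zhu 2026; multiplicative `3` with (ram): Skinner 2016) MODULO the deep
# Tamagawa-defect bound — and the stub's exact obstruction, typed

Cell `bsd-addord`, seat `bsd-addord-w2-c5` (gen 0), item `stmt-BirchSwinnertonDyer-19562` (skeleton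
`Cruxes/DeepUpperAtThreeOffKatoStratum/Lines/birth.lean`: `stub_nonAdditive` / `stub_additiveDefect`).
UPPER-side mirror of w2-c2's `KimAtThreeDeepLowerNonAdditiveRows` (crux 19075 on the same rows).
Theorems only; every printed input is a hypothesis BY NAME; nothing asserted; the crux stays open.

At a tower row of analytic rank `0` with the `3`-adic period transfer write `a = ∂⁽⁰⁾(δ̃)`,
`d = ∂^{(∞)}_{deep}(δ̃) ≤ a`, `s = ord₃ #Ш(E/ℚ)(3)`, `c = v₃(∏_ℓ c_ℓ)`; the crux asks `s + d ≤ a`.  The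
UPPER half of `BSD₃` in Miller's currency (`MissingUpperBoundAt W 3`) reads `s + c ≤ a` (w2-c4 g5's
`KimAtThreeShallowEqDeepOffStratumSockets.sha_add_tamagawa_le_kuriharaPartial_zero_of_missingUpperBoundAt`,
reused), so the crux follows from it with the DEEP TAMAGAWA-DEFECT BOUND `d ≤ c` («(DD)», the `≤` half of Kim's
Conj. 1.10, the residual w2-c3 isolated on the potentially-good stratum in
`KimAtThreeKolyvaginDeepUpperPotGoodReduction`), and GIVEN both halves of `BSD₃` the crux at the row is
EQUIVALENT to (DD).  Unlike the lower half (`c ≤ d`, free at `3 ∤ ∏ c_ℓ`), (DD) is never free: at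
`3 ∤ ∏ c_ℓ` it says that some Kurihara number at arbitrarily deep cyclic levels is a `3`-adic UNIT —
certificate supply, Kim 2025 territory, not in print at `p = 3` (outright only where `3 ∤ #Ш`,
`KimAtThreeDeepUpperShaTrivialRungs.deepUpper_conclusion_of_padicValNat_sha_eq_zero`).
* §1 (odd `p`, BSD currency): `deepUpper_conclusion_of_missingUpperBoundAt_of_deepInfty_le_tamagawa`
  (crux ⟸ upper half ∧ (DD)), `deepUpper_conclusion_iff_deepInfty_le_tamagawa_of_missingPPartAt`.
* §2 (`p = 3`, from `BSDp W 3`): `deepUpper_conclusion_three_of_bsdp_of_deepInfty_le_tamagawa`, `…_iff_…`.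
* §3 `MissingUpperBoundAt W 3` by name on the covered non-additive tower rows: good ordinary (row C16:
  Yan–Zhu 2026 Thm 4.15 `hYZ`, Wuthrich 2014 Lemma 20 `hW20`, `hmod`, `hGZK`), multiplicative with
  (ram) (row C1: Skinner 2016 Thm C `hSk`, `hmod`, `hGZK`).
* §4 the crux's currency (optimal datum `D₀` at the conductor, `¬ Addv W₀ 3`): the period transfer is
  FREE on non-additive rows (w2-c4 g5's `periodTransfer_three_of_optimal_of_not_addv`: `9 ∤ N`, Mazur 1978
  Cor 4.1 `hMazur`); ★ `stub_nonAdditive_of_missingUpperBoundAt_of_deepInfty_le_tamagawa` = the registered stub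
  VERBATIM from `hMazur`, `hGZK` and TWO DISPLAYED residual families (U) = upper half of `BSD₃` on the
  non-additive tower rows of analytic rank `0` (§3 discharges it off good-supersingular `3` and
  multiplicative-without-(ram)), (DD) on those rows (OPEN); ★ `stub_nonAdditive_covered_of_deepInfty_le_tamagawa`
  = the stub on the C16/C1 sub-rows from SEVEN named facts + (DD) alone.
NOT in print (typed as hypotheses): (U) at good supersingular `3` / multiplicative `3` without (ram)
(no `BSD₃` in the tree: corners X6/X8/X11a); (DD) everywhere.
[cite: YanZhu2024MainConjNonCM, Thm. 4.15 (§4.6)] [cite: Wuthrich2014, Lemma 20 (p. 399)]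
[cite: Skinner2016PacificMC, Thm. C (§1)] [cite: Mazur1978, Cor. 4.1] [cite: Miller2011LMS, Def. 1.1]
[cite: Kim2022StructureSelmer, §1.5.1, Conj. 1.10 (PDF pp. 7–8), Thm. 1.9 (6)] [cite: Kim2025RefinedTNC, Thm. 1.1]
-/

set_option autoImplicit false
-- the Theorems namespace of a single-conjunct summit repeats the summit name by design (D-0017)
set_option linter.dupNamespace false

noncomputable section

open scoped MatrixGroups ModularForm Classical

open CongruenceSubgroup WeierstrassCurve Literature.NumberTheory.EllipticCurves
  Literature.NumberTheory.EllipticCurves.ModularForms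
  Literature.NumberTheory.EllipticCurves.Rank1Residual
  Literature.NumberTheory.EllipticCurves.Rank1Residual.Typed

namespace Summit.BirchSwinnertonDyer.BirchSwinnertonDyer.Theorems.KimAtThreeDeepUpperNonAdditiveRows

open Summit.BirchSwinnertonDyer.Rank1Residual
open Summit.BirchSwinnertonDyer.Rank1Residual.Supersingular
open Summit.BirchSwinnertonDyer.BirchSwinnertonDyer.Theses.KimAtThreeKolyvagin
open Summit.BirchSwinnertonDyer.BirchSwinnertonDyer.Theorems.KimAtThreeKolyvaginDeepUpperRung
open Summit.BirchSwinnertonDyer.BirchSwinnertonDyer.Theorems.KimAtThreeKolyvaginUnitLevelOneRungs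
open Summit.BirchSwinnertonDyer.BirchSwinnertonDyer.Theorems.KimAtThreeKolyvaginCertificateDictionary
open Summit.BirchSwinnertonDyer.BirchSwinnertonDyer.Theorems.KimAtThreeDeepLowerSmallDefect
open Summit.BirchSwinnertonDyer.BirchSwinnertonDyer.Theorems.KimAtThreeDeepLowerNonAdditiveRows
open Summit.BirchSwinnertonDyer.BirchSwinnertonDyer.Theorems.KimAtThreeShallowEqDeepOffStratumSockets
open Summit.BirchSwinnertonDyer.BirchSwinnertonDyer.Theorems.KimAtThreeShallowEqDeepOffStratumNonAdditiveRows

/-! ### §1 BSD currency (general odd `p`): the upper half of `BSD_p` bounds `s + c` by `∂⁽⁰⁾` -/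

section BSDCurrency

variable (W : WeierstrassCurve ℚ) [W.IsElliptic] [W.IsGloballyMinimal] (p : ℕ) [Fact p.Prime]
  {N : ℕ} [NeZero N] (f : CuspForm (Gamma0 N) 2)

/-- **Upper half of `BSD_p` ∧ «deep Tamagawa-defect bound» ⇒ the UPPER crux conclusion at the row**
(general odd `p`, same row): `MissingUpperBoundAt W p` gives `s + c ≤ ∂⁽⁰⁾` and `d ≤ c`
(`∂^{(∞)}_{deep}(δ̃) ≤ v_p(∏ c_ℓ)`) closes `∃ d, ∂^{(∞)}_{deep} = d ∧ s + d ≤ ∂⁽⁰⁾`.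
[cite: Kim2022StructureSelmer, Conj. 1.10 (PDF p. 8), Thm. 1.9 (6)] [cite: Miller2011LMS, Def. 1.1] -/
theorem deepUpper_conclusion_of_missingUpperBoundAt_of_deepInfty_le_tamagawa
    (hGZK : rank_eq_analyticRank_of_analyticRank_le_one) (hp2 : p ≠ 2)
    (hirr : W.HasIrreducibleModPGaloisRep p) (hf : IsNewformOf W f)
    (hord : kuriharaVanishingOrder W p f = 0)
    (hper : ∃ u : ℚ, ‖(u : ℚ_[p])‖ = 1 ∧ W.realPeriodRat = u * plusPeriod f)
    (hup : MissingUpperBoundAt W p)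
    (hDD : kuriharaPartialDeepInfty W p f ≤ ((padicValNat p W.tamagawaProduct : ℕ) : ℕ∞)) :
    ∃ d : ℕ, kuriharaPartialDeepInfty W p f = d ∧
      ((padicValNat p (Nat.card (AddCommGroup.primaryComponent W.sha p)) + d : ℕ) : ℕ∞) ≤
        kuriharaPartial W p f 0 := by
  obtain ⟨d, hd, hdle⟩ := ENat.le_coe_iff.mp hDD
  refine ⟨d, hd, le_trans ?_ (sha_add_tamagawa_le_kuriharaPartial_zero_of_missingUpperBoundAt W p f
    hGZK hp2 hirr hf hord hper hup)⟩
  exact_mod_cast Nat.add_le_add_left hdle _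

/-- **On a `BSD_p` row the UPPER crux IS the deep Tamagawa-defect bound**: granted both halves
(`MissingPPartAt W p`), `(∃ d, ∂^{(∞)}_{deep} = d ∧ s + d ≤ ∂⁽⁰⁾) ↔ (d ≤ c)` (`→` by w2-c2's lower
reading `∂⁽⁰⁾ ≤ s + c`): where the `p`-part of BSD is in print, the crux says EXACTLY «some Kurihara
number at arbitrarily deep cyclic levels has `ord_p ≤ ord_p δ̃₁ − ord_p #Ш(p) = v_p(∏ c_ℓ)`».
[cite: Kim2022StructureSelmer, Conj. 1.10 (PDF p. 8), Thm. 1.9 (6)] [cite: Miller2011LMS, Def. 1.1] -/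
theorem deepUpper_conclusion_iff_deepInfty_le_tamagawa_of_missingPPartAt
    (hGZK : rank_eq_analyticRank_of_analyticRank_le_one) (hp2 : p ≠ 2)
    (hirr : W.HasIrreducibleModPGaloisRep p) (hf : IsNewformOf W f)
    (hord : kuriharaVanishingOrder W p f = 0)
    (hper : ∃ u : ℚ, ‖(u : ℚ_[p])‖ = 1 ∧ W.realPeriodRat = u * plusPeriod f)
    (hbsd : MissingPPartAt W p) :
    (∃ d : ℕ, kuriharaPartialDeepInfty W p f = d ∧
      ((padicValNat p (Nat.card (AddCommGroup.primaryComponent W.sha p)) + d : ℕ) : ℕ∞) ≤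
        kuriharaPartial W p f 0) ↔
      kuriharaPartialDeepInfty W p f ≤ ((padicValNat p W.tamagawaProduct : ℕ) : ℕ∞) := by
  obtain ⟨hlow, hup⟩ := lower_and_upper_of_missingPPartAt W p hbsd
  refine ⟨fun ⟨d, hd, hU⟩ => ?_, deepUpper_conclusion_of_missingUpperBoundAt_of_deepInfty_le_tamagawa
    W p f hGZK hp2 hirr hf hord hper hup⟩
  exact deepInfty_le_of_upperRow_of_le_add W p f ⟨d, hd, hU⟩
    (kuriharaPartial_zero_le_sha_add_tamagawa_of_missingLowerBoundAt W p f hGZK hp2 hirr hf hord hper hlow)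

end BSDCurrency

/-! ### §2 `p = 3`: from `BSD(E,3)` (any reduction type at `3`) -/

section Row

variable (W : WeierstrassCurve ℚ) [W.IsElliptic] [W.IsGloballyMinimal]
  {N : ℕ} [NeZero N] (f : CuspForm (Gamma0 N) 2)

/-- **`BSD(E,3)` at a tower row of analytic rank `0` with the `3`-adic period transfer ⟹ the UPPER crux
conclusion, modulo `∂^{(∞)}_{deep}(δ̃) ≤ v₃(∏ c_ℓ)`.** [cite: Miller2011LMS, Def. 1.1] [cite: Kim2022StructureSelmer, Conj. 1.10] -/
theorem deepUpper_conclusion_three_of_bsdp_of_deepInfty_le_tamagawa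
    (hGZK : rank_eq_analyticRank_of_analyticRank_le_one)
    (htower : ∀ n : ℕ, W.HasSurjectiveModNGaloisRep (3 ^ n : ℕ)) (hfin : Finite W.sha)
    (hf : IsNewformOf W f) (hord : kuriharaVanishingOrder W 3 f = 0)
    (hper : ∃ u : ℚ, ‖(u : ℚ_[3])‖ = 1 ∧ W.realPeriodRat = u * plusPeriod f)
    (hbsd : haveI : Fact (Nat.Prime 3) := ⟨Nat.prime_three⟩; BSDp W 3)
    (hDD : kuriharaPartialDeepInfty W 3 f ≤ ((padicValNat 3 W.tamagawaProduct : ℕ) : ℕ∞)) :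
    ∃ d : ℕ, kuriharaPartialDeepInfty W 3 f = d ∧
      ((padicValNat 3 (Nat.card (AddCommGroup.primaryComponent W.sha 3)) + d : ℕ) : ℕ∞) ≤
        kuriharaPartial W 3 f 0 := by
  haveI : Fact (Nat.Prime 3) := ⟨Nat.prime_three⟩
  haveI : Finite W.sha := hfin
  exact deepUpper_conclusion_of_missingUpperBoundAt_of_deepInfty_le_tamagawa W 3 f hGZK (by norm_num)
    (hasIrreducibleModPGaloisRep_of_hasSurjectiveModNGaloisRep W 3 (by simpa using htower 1))
    hf hord hper (lower_and_upper_of_missingPPartAt W 3 (missingPPartAt_of_bsdp W 3 hbsd)).2 hDD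

/-- **On a `BSD(E,3)` tower row the UPPER crux conclusion is EQUIVALENT to the deep Tamagawa-defect
bound.** [cite: Miller2011LMS, Def. 1.1] [cite: Kim2022StructureSelmer, Conj. 1.10 (PDF p. 8)] -/
theorem deepUpper_conclusion_three_iff_deepInfty_le_tamagawa_of_bsdp
    (hGZK : rank_eq_analyticRank_of_analyticRank_le_one)
    (htower : ∀ n : ℕ, W.HasSurjectiveModNGaloisRep (3 ^ n : ℕ)) (hfin : Finite W.sha)
    (hf : IsNewformOf W f) (hord : kuriharaVanishingOrder W 3 f = 0)
    (hper : ∃ u : ℚ, ‖(u : ℚ_[3])‖ = 1 ∧ W.realPeriodRat = u * plusPeriod f)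
    (hbsd : haveI : Fact (Nat.Prime 3) := ⟨Nat.prime_three⟩; BSDp W 3) :
    (∃ d : ℕ, kuriharaPartialDeepInfty W 3 f = d ∧
      ((padicValNat 3 (Nat.card (AddCommGroup.primaryComponent W.sha 3)) + d : ℕ) : ℕ∞) ≤
        kuriharaPartial W 3 f 0) ↔
      kuriharaPartialDeepInfty W 3 f ≤ ((padicValNat 3 W.tamagawaProduct : ℕ) : ℕ∞) := by
  haveI : Fact (Nat.Prime 3) := ⟨Nat.prime_three⟩
  haveI : Finite W.sha := hfin
  exact deepUpper_conclusion_iff_deepInfty_le_tamagawa_of_missingPPartAt W 3 f hGZK (by norm_num)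
    (hasIrreducibleModPGaloisRep_of_hasSurjectiveModNGaloisRep W 3 (by simpa using htower 1))
    hf hord hper (missingPPartAt_of_bsdp W 3 hbsd)

end Row

/-! ### §3 The UPPER half of `BSD₃` on the covered non-additive tower rows, by name -/

/-- **Good ordinary `3`, tower onto, analytic rank `0` ⟹ `MissingUpperBoundAt W 3`** (row C16:
`BSDp W 3` from Yan–Zhu 2026 Thm. 4.15 `hYZ`, Wuthrich 2014 Lemma 20 `hW20` for the `3`-adic image,
modularity `hmod`, GZK `hGZK`; then Miller's bookkeeping). [cite: YanZhu2024MainConjNonCM, Thm. 4.15 (§4.6)]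
[cite: Wuthrich2014, Lemma 20 (p. 399)] [cite: Miller2011LMS, Def. 1.1] -/
theorem missingUpperBoundAt_three_of_goodOrd_of_towerSurj
    (hYZ : YanZhu2026.thm415_padicValRat_bsd_rank_le_one)
    (hW20 : Wuthrich2014.lemma20_surjective_threeAdic_of_semistable)
    (hmod : hasEntireLFunction_rat) (hGZK : rank_eq_analyticRank_of_analyticRank_le_one)
    (W : WeierstrassCurve ℚ) [W.IsElliptic] [W.IsGloballyMinimal]
    (htower : ∀ n : ℕ, W.HasSurjectiveModNGaloisRep (3 ^ n : ℕ)) (hr0 : W.analyticRank = 0)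
    (hgood : W.HasGoodReductionAtPrime 3) (hord3 : ¬ (3 : ℤ) ∣ W.frobeniusTrace 3) :
    MissingUpperBoundAt W 3 := by
  haveI : Fact (Nat.Prime 3) := ⟨Nat.prime_three⟩
  have hsurj : Surj W 3 := by
    have h := htower 1
    rw [pow_one] at h
    exact h
  have hirr : Irr W 3 := hasIrreducibleModPGaloisRep_of_hasSurjectiveModNGaloisRep W 3 hsurj
  have hC16 : RowC16 W 3 := ⟨rfl, ⟨hgood, by exact_mod_cast hord3⟩, hirr, Or.inl hsurj⟩
  haveI : Finite W.sha := (hGZK W (by rw [hr0]; exact zero_le_one)).2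
  exact (lower_and_upper_of_missingPPartAt W 3 (missingPPartAt_of_bsdp W 3
    (RowC16.bsdp hYZ hW20 hmod hGZK (by rw [hr0]; exact zero_le_one) hC16))).2

/-- **Multiplicative `3` with (ram), tower onto, analytic rank `0` ⟹ `MissingUpperBoundAt W 3`** (row C1:
`BSDp W 3` from Skinner 2016 Thm. C `hSk`, `hmod`, `hGZK`). [cite: Skinner2016PacificMC, Thm. C (§1)] -/
theorem missingUpperBoundAt_three_of_mult_of_ram
    (hSk : Skinner2016.thmC_padicValRat_bsd_rank_zero)
    (hmod : hasEntireLFunction_rat) (hGZK : rank_eq_analyticRank_of_analyticRank_le_one)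
    (W : WeierstrassCurve ℚ) [W.IsElliptic] [W.IsGloballyMinimal]
    (htower : ∀ n : ℕ, W.HasSurjectiveModNGaloisRep (3 ^ n : ℕ)) (hr0 : W.analyticRank = 0)
    (hmult : W.HasMultiplicativeReductionAtPrime 3)
    (hram : haveI : Fact (Nat.Prime 3) := ⟨Nat.prime_three⟩; Ram W 3) :
    MissingUpperBoundAt W 3 := by
  haveI : Fact (Nat.Prime 3) := ⟨Nat.prime_three⟩
  have hsurj : Surj W 3 := by
    have h := htower 1
    rw [pow_one] at h
    exact h
  have hirr : Irr W 3 := hasIrreducibleModPGaloisRep_of_hasSurjectiveModNGaloisRep W 3 hsurj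
  have hC1 : RowC1 W 3 := ⟨hr0, le_rfl, Or.inr hmult, hirr, hram⟩
  haveI : Finite W.sha := (hGZK W (by rw [hr0]; exact zero_le_one)).2
  exact (lower_and_upper_of_missingPPartAt W 3 (missingPPartAt_of_bsdp W 3
    (RowC1.bsdp hSk hmod hGZK hC1))).2

/-! ### §4 The crux's own currency: optimal datum at the conductor, `¬ Addv W₀ 3` -/

/-- ★ **The registered stub `stub_nonAdditive` of crux 19562, VERBATIM, from Mazur 1978 Cor. 4.1
(`hMazur`), GZK (`hGZK`) and TWO DISPLAYED residual families on the non-additive tower rows of analytic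
rank `0`**: (U) the UPPER half of `BSD₃` (`MissingUpperBoundAt W 3`; §3 discharges it on good-ordinary
rows and multiplicative rows with (ram); OPEN at good supersingular `3` / multiplicative `3` without
(ram)), (DD) `∂^{(∞)}_{deep}(δ̃) ≤ v₃(∏ c_ℓ)` (OPEN; by §1 also NECESSARY given `BSD₃`).  The period
transfer is discharged at the optimal datum (`periodTransfer_three_of_optimal_of_not_addv`), then §1.
[cite: Mazur1978, Cor. 4.1] [cite: Miller2011LMS, Def. 1.1] [cite: Kim2022StructureSelmer, Conj. 1.10 (PDF p. 8)] -/
theorem stub_nonAdditive_of_missingUpperBoundAt_of_deepInfty_le_tamagawa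
    (hMazur : mazur_not_dvd_maninConstant_of_odd)
    (hGZK : rank_eq_analyticRank_of_analyticRank_le_one)
    (hU : ∀ (W : WeierstrassCurve ℚ) [W.IsElliptic] [W.IsGloballyMinimal],
      (∀ n : ℕ, W.HasSurjectiveModNGaloisRep (3 ^ n : ℕ)) → W.analyticRank = 0 →
      ¬ (haveI : Fact (Nat.Prime 3) := ⟨Nat.prime_three⟩; Addv W 3) → MissingUpperBoundAt W 3)
    (hDD : ∀ (W : WeierstrassCurve ℚ) [W.IsElliptic] [W.IsGloballyMinimal],
      (∀ n : ℕ, W.HasSurjectiveModNGaloisRep (3 ^ n : ℕ)) →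
      ∀ {N : ℕ} [NeZero N] (f : CuspForm (Gamma0 N) 2), IsNewformOf W f →
      kuriharaVanishingOrder W 3 f = 0 →
      ¬ (haveI : Fact (Nat.Prime 3) := ⟨Nat.prime_three⟩; Addv W 3) →
        kuriharaPartialDeepInfty W 3 f ≤ ((padicValNat 3 W.tamagawaProduct : ℕ) : ℕ∞)) :
    ∀ (W₀ : WeierstrassCurve ℚ) [W₀.IsElliptic] [W₀.IsGloballyMinimal],
      (∀ n : ℕ, W₀.HasSurjectiveModNGaloisRep (3 ^ n : ℕ)) → Finite W₀.sha →
      ∀ {N : ℕ} [NeZero N], N = W₀.conductorNorm ℤ →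
      ∀ (D₀ : ModularParametrizationData W₀ N),
        (∀ z ∈ D₀.L.lattice, ∃ w ∈ periodLattice D₀.f, z = D₀.c * w) →
        (∀ (W₂ : WeierstrassCurve ℚ) [W₂.IsElliptic] (D₂ : ModularParametrizationData W₂ N),
          D₂.f = D₀.f → D₀.modularDegree ≤ D₂.modularDegree) →
        (∀ r : ℚ, ratPlusSymbol D₀.f r ≠ 0 → 0 ≤ padicValRat 3 (ratPlusSymbol D₀.f r)) →
        kuriharaVanishingOrder W₀ 3 D₀.f = 0 →
        ¬ (haveI : Fact (Nat.Prime 3) := ⟨Nat.prime_three⟩; Addv W₀ 3) →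
        ∃ d : ℕ, kuriharaPartialDeepInfty W₀ 3 D₀.f = d ∧
          ((padicValNat 3 (Nat.card (AddCommGroup.primaryComponent W₀.sha 3)) + d : ℕ) : ℕ∞) ≤
            kuriharaPartial W₀ 3 D₀.f 0 := by
  intro W₀ _ _ htower _ N _ hN D₀ hopt _ _ hord hnA
  haveI : Fact (Nat.Prime 3) := ⟨Nat.prime_three⟩
  have hf : IsNewformOf W₀ D₀.f := D₀.isNewformOf
  have hr0 : W₀.analyticRank = 0 := analyticRank_eq_zero_of_kuriharaVanishingOrder_eq_zero W₀ D₀.f hf hord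
  exact deepUpper_conclusion_of_missingUpperBoundAt_of_deepInfty_le_tamagawa W₀ 3 D₀.f hGZK (by norm_num)
    (hasIrreducibleModPGaloisRep_of_hasSurjectiveModNGaloisRep W₀ 3 (by simpa using htower 1)) hf hord
    (periodTransfer_three_of_optimal_of_not_addv W₀ hMazur hN D₀ hopt hnA) (hU W₀ htower hr0 hnA)
    (hDD W₀ htower D₀.f hf hord hnA)

/-- ★ **`stub_nonAdditive` on its COVERED sub-rows from SEVEN named facts + (DD) alone**: on the rows
of crux 19562 (binders verbatim, `¬ Addv W₀ 3`) that are good ORDINARY at `3` or multiplicative at `3`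
WITH (ram), the UPPER conclusion follows from `hYZ`, `hW20`, `hSk`, `hmod`, `hGZK`, `hMazur` and (DD) at
the row.  Gap to the registered stub: (i) (DD), OPEN; (ii) good SUPERSINGULAR `3` and multiplicative `3`
WITHOUT (ram), where not even `BSD₃` is in the tree. [cite: YanZhu2024MainConjNonCM, Thm. 4.15 (§4.6)]
[cite: Skinner2016PacificMC, Thm. C (§1)] [cite: Mazur1978, Cor. 4.1] [cite: Kim2022StructureSelmer, Conj. 1.10 (PDF p. 8)] -/
theorem stub_nonAdditive_covered_of_deepInfty_le_tamagawa
    (hYZ : YanZhu2026.thm415_padicValRat_bsd_rank_le_one)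
    (hW20 : Wuthrich2014.lemma20_surjective_threeAdic_of_semistable)
    (hSk : Skinner2016.thmC_padicValRat_bsd_rank_zero)
    (hmod : hasEntireLFunction_rat) (hGZK : rank_eq_analyticRank_of_analyticRank_le_one)
    (hMazur : mazur_not_dvd_maninConstant_of_odd) :
    ∀ (W₀ : WeierstrassCurve ℚ) [W₀.IsElliptic] [W₀.IsGloballyMinimal],
      (∀ n : ℕ, W₀.HasSurjectiveModNGaloisRep (3 ^ n : ℕ)) → Finite W₀.sha →
      ∀ {N : ℕ} [NeZero N], N = W₀.conductorNorm ℤ →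
      ∀ (D₀ : ModularParametrizationData W₀ N),
        (∀ z ∈ D₀.L.lattice, ∃ w ∈ periodLattice D₀.f, z = D₀.c * w) →
        (∀ (W₂ : WeierstrassCurve ℚ) [W₂.IsElliptic] (D₂ : ModularParametrizationData W₂ N),
          D₂.f = D₀.f → D₀.modularDegree ≤ D₂.modularDegree) →
        (∀ r : ℚ, ratPlusSymbol D₀.f r ≠ 0 → 0 ≤ padicValRat 3 (ratPlusSymbol D₀.f r)) →
        kuriharaVanishingOrder W₀ 3 D₀.f = 0 →
        ¬ (haveI : Fact (Nat.Prime 3) := ⟨Nat.prime_three⟩; Addv W₀ 3) →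
        -- the covered sub-rows: ordinary if good, (ram) if multiplicative
        (W₀.HasGoodReductionAtPrime 3 → ¬ (3 : ℤ) ∣ W₀.frobeniusTrace 3) →
        (W₀.HasMultiplicativeReductionAtPrime 3 →
          (haveI : Fact (Nat.Prime 3) := ⟨Nat.prime_three⟩; Ram W₀ 3)) →
        -- (DD) at the row
        kuriharaPartialDeepInfty W₀ 3 D₀.f ≤ ((padicValNat 3 W₀.tamagawaProduct : ℕ) : ℕ∞) →
        ∃ d : ℕ, kuriharaPartialDeepInfty W₀ 3 D₀.f = d ∧
          ((padicValNat 3 (Nat.card (AddCommGroup.primaryComponent W₀.sha 3)) + d : ℕ) : ℕ∞) ≤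
            kuriharaPartial W₀ 3 D₀.f 0 := by
  intro W₀ _ _ htower _ N _ hN D₀ hopt _ _ hord hnA hordinary hram hDD
  haveI : Fact (Nat.Prime 3) := ⟨Nat.prime_three⟩
  have hf : IsNewformOf W₀ D₀.f := D₀.isNewformOf
  have hr0 : W₀.analyticRank = 0 := analyticRank_eq_zero_of_kuriharaVanishingOrder_eq_zero W₀ D₀.f hf hord
  have hup : MissingUpperBoundAt W₀ 3 := by
    by_cases hgood : W₀.HasGoodReductionAtPrime 3
    · exact missingUpperBoundAt_three_of_goodOrd_of_towerSurj hYZ hW20 hmod hGZK W₀ htower hr0 hgood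
        (hordinary hgood)
    · have hmult : W₀.HasMultiplicativeReductionAtPrime 3 := by
        by_contra h
        exact hnA ⟨hgood, h⟩
      exact missingUpperBoundAt_three_of_mult_of_ram hSk hmod hGZK W₀ htower hr0 hmult (hram hmult)
  exact deepUpper_conclusion_of_missingUpperBoundAt_of_deepInfty_le_tamagawa W₀ 3 D₀.f hGZK (by norm_num)
    (hasIrreducibleModPGaloisRep_of_hasSurjectiveModNGaloisRep W₀ 3 (by simpa using htower 1)) hf hord
    (periodTransfer_three_of_optimal_of_not_addv W₀ hMazur hN D₀ hopt hnA) hup hDD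

end Summit.BirchSwinnertonDyer.BirchSwinnertonDyer.Theorems.KimAtThreeDeepUpperNonAdditiveRows

end
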